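import Mathlib
import HarnessLib
import Summits.HubbardSuperconductivity.HubbardSuperconductivity.Theorems.KLProgrammeKLRegimeEngineTowerInstProfileLevRateFBase

/-!
# Route `KLProgramme` — crux K3 ENGINE (stmt-HubbardSuperconductivity-20437 `KLRegimeEngineV17F2`), stub (b) v2, THE LEVELS PACKAGE (ℓ), located item
# «(ℓ)-READOUT-F» piece (RO-1): THE READ-OUT PROFILE — the input `𝒱_{dk}` of block `k` RE-MEASURED AT ANY FINER FAMILY `F_{J′}`, `J′ ≥ dk`, in floor units,
# obeys the SAME profile as the law's input profile (cell gate-hubbard-kl, seat hubbard-kl-k3c3-p2 g16; read-out twin of …TowerRemeasureLevBase §3 (p4 g19),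
# …TowerInstRemeasureLevFBase §1–§3 and …TowerInstProfileLevRateFBase §1 (k3c2-p3 g12))

WHY.  The floor-keyed law (`klTowerBLevF_le_law_lev_of_blocks[_Z]`) bounds the BORN arrays of the block increments `Δ_{k′}` at their born families `F_{dk′}`
and reads the INPUT `𝒱_{dk}` only at the block's input family `F_{dk−1}`.  Stub (b)'s conjunct `KernelNormsLevels … (K_n) j` reads the action `𝒱_j` at ITS OWN
family `F_j` for EVERY `j ≤ n`; with `j ∈ [dk, d(k+1))`, `𝒱_j = 𝒱_{dk} + (𝒱_j − 𝒱_{dk})`, and E1's part 7 `towerReadout_le` needs the measured profile of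
`𝒱_{dk}` AT THE READ-OUT FAMILY `F_j`.  This file supplies it: the re-based decomposition `𝒱_{dk} = 𝒱_d + Σ_{1≤k′<k} Δ_{k′}` re-measured at any `F_{J′}` with
`dk ≤ J′` (the jump suppliers `klLevNormOf_jump_le_klEng_uniform` / `klLevNormOf_base_remeasure_le_klEng_uniform` are target-generic), divided by the floor unit
AT `J′`.  The unit algebra is the law's: a jump of `Δ` families against `Δ` unit ratios is the pure gain `((2^{e_F})⁻¹)^Δ`, `e_F = p + t − klLevGain t − 3`, so a
finer read-out family only LOWERS the profile — the read-out profile is the law's input profile `(A′, Q′)` verbatim, and part 7's numerics are the law's own.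

* §1 `klLevNormOf_klTowerInput_le_base_at` — linearity at any family;
* §2 **`klLevNormOf_klTowerInput_readout_le_kitSum_uniform`** — `klLevNormOf … J′ (m+1) 𝒱_{dk} Ωe ≤ C₁C₂^m·(2^{J′−(d−1)})^{m−F}·N_b + Σ_{1≤k′<k} C₁C₂^m·(2^{J′−dk′})^{m−F}·
  klTowerBornLev … d k′ (m+1) F` (`2 ≤ d`, `1 ≤ k`, `dk ≤ J′ ≤ nScales β + 1`, m-uniform constants);
* §3 `jumpPow_mul_div_klLevUnitF_add` — `(2^Δ)^{2p−2−t}·X / klLevUnitF … t p (J+Δ) = ((2^{e_F})⁻¹)^Δ·(X / klLevUnitF … t p J)`;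
* §4 **`readoutLevF_le_kitSum`** — the floor read-out row: `27^{t+1}·klLevNormOf … J′ (2p) 𝒱_{dk} Ωe / klLevUnitF … t p J′ ≤ 27^{t+1}·C₁C₂^{2p−1}·
  ( ((2^{e_F})⁻¹)^{J′−(d−1)}·(N_b/klLevUnitF … t p (d−1)) + Σ_{1≤k′<k} ((2^{e_F})⁻¹)^{J′−dk′}·klTowerBLevF … d t (k′+1) p )`;
* §5 **`readoutLevF_le_profileR`** — under the base unit law `N_b/unitF(d−1) ≤ A_b λ^{p−1} Q_b^p` and the law on the blocks `2 ≤ k′+1 ≤ k`, for `2d − 2 ≤ J′`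
  and `7 ≤ 2p + t`: `… ≤ 27⁵(C₁/C₂)·8^{d−1}·(A_b + A/(1−(2^d)⁻¹))·λ^{p−1}·(C₂²·(2^{d−1})⁻¹·max Q Q_b)^p` — THE SAME CONSTANTS as `klTowerMuLevAtF_le_profileR_base`.
Compositions of landed theorems and real algebra; nothing about the model is asserted beyond them; nothing asserts (ℓ), any stub, K3 or superconductivity.
References: BGM 2006 §2.8 (2.76), (2.82)–(2.84), (2.88)–(2.90), (2.93)–(2.98) [cite: BenfattoGiulianiMastropietro2006].
-/

noncomputable section

namespace Summit.HubbardSuperconductivity.HubbardSuperconductivity.Theorems.EngineV8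

set_option linter.dupNamespace false -- summit = problem name (single-conjunct summit), D-0017

open Classical
open Real Finset Literature.MathematicalPhysics.QuantumLattice Literature.Probability.LatticeModels GrassmannAlgebra
open Literature.MathematicalPhysics.QuantumLattice.FermiRG
open Summit.HubbardSuperconductivity.HubbardSuperconductivity.Theorems.KLProgrammeLegKernels
open Summit.HubbardSuperconductivity.HubbardSuperconductivity.Theorems.KLRegimeSplit
open Summit.HubbardSuperconductivity.HubbardSuperconductivity.Theorems.KLRegimeWick
open Summit.HubbardSuperconductivity.HubbardSuperconductivity.Theorems.TorusFourierL2
open Summit.HubbardSuperconductivity.HubbardSuperconductivity.Theorems.DispersionFlow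
open Summit.HubbardSuperconductivity.HubbardSuperconductivity.Theorems.PerturbedFermiCurve

variable {L M : ℕ} [NeZero L] [NeZero M]

/-! ## §1 Linearity of the re-based decomposition at any family -/

omit [NeZero M] in
/-- **Pointwise form, levelled, re-based, ANY family `F_{J′}`**: the levelled norm of `𝒱_{dk}` at `F_{J′}` is at most that of the base `𝒱_d` plus those of
`Δ_{k′}`, `1 ≤ k′ < k` (read-out twin of `klLevNormOf_klTowerInput_le_base`). -/
theorem klLevNormOf_klTowerInput_le_base_at {β : ℝ} (hβ : 0 ≤ β) (U μ : ℝ) (K : TrigPolyC4v) (d : ℕ) {k : ℕ} (hk : 1 ≤ k) (J' m : ℕ)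
    (Ωe : Fin m → Option (SectorLeg (sectorCount J'))) :
    klLevNormOf L M β μ K J' m (klTowerInput L M β U μ K d k) Ωe ≤
      klLevNormOf L M β μ K J' m (klTowerInput L M β U μ K d 1) Ωe +
        ∑ k' ∈ Ico 1 k, klLevNormOf L M β μ K J' m (klTowerIncr L M β U μ K d k') Ωe := by
  rw [klTowerInput_eq_one_add_sum β U μ K d hk]
  exact (klLevNormOf_add_le hβ μ K _ m _ _ Ωe).trans (by gcongr; exact klLevNormOf_sum_le hβ μ K _ m _ _ Ωe)

/-! ## §2 The read-out kit sum in absolute units, m-uniform constants -/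

omit [NeZero L] [NeZero M] in
/-- **THE INPUT `𝒱_{dk}` RE-MEASURED AT A READ-OUT FAMILY `F_{J′}`, `dk ≤ J′ ≤ nScales β + 1`, m-UNIFORM** (read-out twin of
`klTowerMeasLev_le_base_add_sum_bornLev_klEng_uniform`): `C₁, C₂` and the thresholds fixed before the degree; for every `m`, `d ≥ 2`, `k ≥ 1`, level count `F`,
BASE bound `N_b` (levelled norms of `𝒱_d` at `F_{d−1}`, level `F`) and every prescription `Ωe` of level `F` at `F_{J′}`,
`klLevNormOf … J′ (m+1) 𝒱_{dk} Ωe ≤ C₁C₂^m·(2^{J′−(d−1)})^{m−F}·N_b + Σ_{1≤k′<k} C₁C₂^m·(2^{J′−dk′})^{m−F}·klTowerBornLev … d k′ (m+1) F`.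
[cite: BenfattoGiulianiMastropietro2006, §2.8 (2.76), (2.82)-(2.84), (2.93)-(2.98)] -/
theorem klLevNormOf_klTowerInput_readout_le_kitSum_uniform :
    ∃ C₁ C₂ : ℝ, 0 < C₁ ∧ 0 < C₂ ∧ ∀ R : RenConsts, R.WF2 → ∃ c₃' : ℝ, 0 < c₃' ∧ ∃ U₀' : ℝ, 0 < U₀' ∧ ∀ m : ℕ,
      ∀ (P : SplitConsts) (c : ℝ), P.WF → 0 < c → c ≤ klEngC₃6 P R → c ≤ c₃' →
      ∀ μ ∈ klWindowC, ∀ U : ℝ, 0 < U → U ≤ klEngU₀9 P R c → U ≤ U₀' → ∀ β : ℝ, klBetaMin ≤ β → β ≤ Real.exp (c / U ^ 2) →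
      ∀ K : TrigPolyC4v, FrameOK R U (nScales β) μ K → ∀ (L M : ℕ) [NeZero L] [NeZero M],
      klEngL₃ β U ≤ L → klEngM₃ β U L ≤ M → ∀ d k J' : ℕ, 2 ≤ d → 1 ≤ k → d * k ≤ J' → J' ≤ nScales β + 1 →
      ∀ F : ℕ, ∀ Nb : ℝ, 0 ≤ Nb →
        (∀ Ωe' : Fin (m + 1) → Option (SectorLeg (sectorCount (d - 1))), levelCount Ωe' = F →
          klLevNormOf L M β μ K (d - 1) (m + 1) (klTowerInput L M β U μ K d 1) Ωe' ≤ Nb) →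
        ∀ Ωe : Fin (m + 1) → Option (SectorLeg (sectorCount J')), levelCount Ωe = F →
        klLevNormOf L M β μ K J' (m + 1) (klTowerInput L M β U μ K d k) Ωe ≤
          C₁ * C₂ ^ m * ((2 : ℝ) ^ (J' - (d - 1))) ^ (m - F) * Nb +
            ∑ k' ∈ Ico 1 k, C₁ * C₂ ^ m * ((2 : ℝ) ^ (J' - d * k')) ^ (m - F) * klTowerBornLev L M β U μ K d k' (m + 1) F := by
  obtain ⟨C₁, C₂, hC₁, hC₂, hbase⟩ := klLevNormOf_base_remeasure_le_klEng_uniform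
  obtain ⟨C₁', C₂', hC₁', hC₂', hrel⟩ := klLevNormOf_jump_le_klEng_uniform
  refine ⟨max C₁ C₁', max C₂ C₂', by positivity, by positivity, fun R hR2 => ?_⟩
  obtain ⟨c₁', hc₁', U₁', hU₁', hbase'⟩ := hbase R hR2
  obtain ⟨c₃', hc₃', U₃', hU₃', hrel'⟩ := hrel R hR2
  refine ⟨min c₁' c₃', by positivity, min U₁' U₃', by positivity, ?_⟩
  intro m P c hP hc hc6 hcmin μ hμ U hU hU9 hUmin β hβmin hβc K hK L M _ _ hL3 hM3 d k J' hd hk1 hkJ hJN F Nb hN0 hN Ωe hlev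
  have hβ : 0 < β := KLRegimeSplit.pos_of_klBetaMin_le hβmin
  obtain ⟨hc₁, hc₃⟩ : c ≤ c₁' ∧ c ≤ c₃' := le_min_iff.1 hcmin
  obtain ⟨hU₁, hU₃⟩ : U ≤ U₁' ∧ U ≤ U₃' := le_min_iff.1 hUmin
  have hdJ : d ≤ J' := le_trans (Nat.le_mul_of_pos_right d hk1) hkJ
  have hmax : C₁ * C₂ ^ m ≤ max C₁ C₁' * (max C₂ C₂') ^ m :=
    mul_le_mul (le_max_left _ _) (pow_le_pow_left₀ hC₂.le (le_max_left _ _) m) (by positivity) (by positivity)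
  have hmax' : C₁' * C₂' ^ m ≤ max C₁ C₁' * (max C₂ C₂') ^ m :=
    mul_le_mul (le_max_right _ _) (pow_le_pow_left₀ hC₂'.le (le_max_right _ _) m) (by positivity) (by positivity)
  refine (klLevNormOf_klTowerInput_le_base_at (L := L) (M := M) hβ.le U μ K d hk1 J' (m + 1) Ωe).trans (add_le_add ?_ (sum_le_sum fun k' hk' => ?_))
  · -- the base `𝒱_d`, jumped from `F_{d−1}` to `F_{J′}`
    have h := hbase' m P c hP hc hc6 hc₁ μ hμ U hU hU9 hU₁ β hβmin hβc K hK L M hL3 hM3 d J' (by omega) hdJ hJN Ωe Nb hN0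
      (fun Ωe' hlev' => hN Ωe' (hlev'.trans hlev))
    rw [hlev] at h
    exact h.trans (mul_le_mul_of_nonneg_right (mul_le_mul_of_nonneg_right hmax (by positivity)) hN0)
  · -- the increment `Δ_{k′}`, jumped from `F_{dk′}` to `F_{J′}`
    have hk'k : k' < k := (mem_Ico.1 hk').2
    have hJk' : d * k' + 1 ≤ J' := by
      have : d * k' + d ≤ d * k := by rw [← Nat.mul_succ]; exact Nat.mul_le_mul_left d hk'k
      omega
    have h := hrel' m P c hP hc hc6 hc₃ μ hμ U hU hU9 hU₃ β hβmin hβc K hK L M hL3 hM3 (d * k') J' hJk' hJN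
      (klTowerIncr L M β U μ K d k') (fun m' X hX => klTowerIncr_momentumConserving β U μ K d k' m' X hX) Ωe
      (klTowerBornLev L M β U μ K d k' (m + 1) (levelCount Ωe)) (klTowerBornLev_nonneg hβ.le U μ K d k' (m + 1) _)
      (fun Ωe' hlev' => by rw [← hlev']; exact klLevNormOf_le_klTowerBornLev β U μ K d k' (m + 1) Ωe')
    rw [hlev] at h
    exact h.trans (mul_le_mul_of_nonneg_right (mul_le_mul_of_nonneg_right hmax' (by positivity))
      (klTowerBornLev_nonneg hβ.le U μ K d k' (m + 1) F))

/-! ## §3 The unit algebra: a jump of `Δ` families against `Δ` floor unit ratios is a pure gain -/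

omit [NeZero L] in
/-- **Jump factor over floor units**: `(2^Δ)^{2p−1−(t+1)}·X / klLevUnitF … t p (J + Δ) = ((2^{p+t−klLevGain t−3})⁻¹)^Δ·(X / klLevUnitF … t p J)`
(`t + 2 ≤ 2p`, `3 ≤ p`; `klLevUnitF_add` ∘ `jump_div_klLevRatioF_eq`). [folklore] -/
theorem jumpPow_mul_div_klLevUnitF_add {β : ℝ} (hβ : 0 < β) (t : Fin 5) {p : ℕ} (h1 : (t : ℕ) + 2 ≤ 2 * p) (h3 : 3 ≤ p)
    (J Δ : ℕ) (X : ℝ) :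
    ((2 : ℝ) ^ Δ) ^ (2 * p - 1 - ((t : ℕ) + 1)) * X / klLevUnitF β M t p (J + Δ) =
      (((2 : ℝ) ^ (p + (t : ℕ) - klLevGain t - 3))⁻¹) ^ Δ * (X / klLevUnitF β M t p J) := by
  have hu0 : 0 < klLevUnitF β M t p J := klLevUnitF_pos hβ t p _
  have hr0 : 0 < klLevRatioF t p := klLevRatioF_pos t p
  rw [klLevUnitF_add, show 2 * p - 1 - ((t : ℕ) + 1) = 2 * p - 2 - (t : ℕ) by omega, ← pow_mul, mul_comm Δ, pow_mul,
    ← jump_div_klLevRatioF_eq t h1 h3, div_pow]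
  field_simp

/-! ## §4 The floor read-out row -/

omit [NeZero L] [NeZero M] in
/-- **THE FLOOR READ-OUT ROW** (`2 ≤ d`, `1 ≤ k`, `dk ≤ J′ ≤ nScales β + 1`, `t + 2 ≤ 2p`, `3 ≤ p`, base bound `N_b` of the level-`(t+1)` norms of `𝒱_d`
at `F_{d−1}` in degree `2p`): for every prescription `Ωe` of level `t + 1` at `F_{J′}`,
`27^{t+1}·klLevNormOf … J′ (2p) 𝒱_{dk} Ωe / klLevUnitF … t p J′ ≤ 27^{t+1}·C₁C₂^{2p−1}·( ((2^{e_F})⁻¹)^{J′−(d−1)}·(N_b/klLevUnitF … t p (d−1)) +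
Σ_{1≤k′<k} ((2^{e_F})⁻¹)^{J′−dk′}·klTowerBLevF … d t (k′+1) p )`, `e_F = p + t − klLevGain t − 3`. [cite: BenfattoGiulianiMastropietro2006, §2.8 (2.83), (2.93)-(2.98)] -/
theorem readoutLevF_le_kitSum :
    ∃ C₁ C₂ : ℝ, 0 < C₁ ∧ 0 < C₂ ∧ ∀ R : RenConsts, R.WF2 → ∃ c₃' : ℝ, 0 < c₃' ∧ ∃ U₀' : ℝ, 0 < U₀' ∧
      ∀ (P : SplitConsts) (c : ℝ), P.WF → 0 < c → c ≤ klEngC₃6 P R → c ≤ c₃' →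
      ∀ μ ∈ klWindowC, ∀ U : ℝ, 0 < U → U ≤ klEngU₀9 P R c → U ≤ U₀' → ∀ β : ℝ, klBetaMin ≤ β → β ≤ Real.exp (c / U ^ 2) →
      ∀ K : TrigPolyC4v, FrameOK R U (nScales β) μ K → ∀ (L M : ℕ) [NeZero L] [NeZero M],
      klEngL₃ β U ≤ L → klEngM₃ β U L ≤ M → ∀ d k J' : ℕ, 2 ≤ d → 1 ≤ k → d * k ≤ J' → J' ≤ nScales β + 1 →
      ∀ (t : Fin 5) (p : ℕ), (t : ℕ) + 2 ≤ 2 * p → 3 ≤ p → ∀ Nb : ℝ, 0 ≤ Nb →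
        (∀ Ωe' : Fin (2 * p) → Option (SectorLeg (sectorCount (d - 1))), levelCount Ωe' = (t : ℕ) + 1 →
          klLevNormOf L M β μ K (d - 1) (2 * p) (klTowerInput L M β U μ K d 1) Ωe' ≤ Nb) →
        ∀ Ωe : Fin (2 * p) → Option (SectorLeg (sectorCount J')), levelCount Ωe = (t : ℕ) + 1 →
        (27 : ℝ) ^ ((t : ℕ) + 1) * klLevNormOf L M β μ K J' (2 * p) (klTowerInput L M β U μ K d k) Ωe / klLevUnitF β M t p J' ≤
          (27 : ℝ) ^ ((t : ℕ) + 1) * (C₁ * C₂ ^ (2 * p - 1)) *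
            ((((2 : ℝ) ^ (p + (t : ℕ) - klLevGain t - 3))⁻¹) ^ (J' - (d - 1)) * (Nb / klLevUnitF β M t p (d - 1)) +
              ∑ k' ∈ Ico 1 k, (((2 : ℝ) ^ (p + (t : ℕ) - klLevGain t - 3))⁻¹) ^ (J' - d * k') *
                klTowerBLevF L M β U μ K d t (k' + 1) p) := by
  obtain ⟨C₁, C₂, hC₁, hC₂, h⟩ := klLevNormOf_klTowerInput_readout_le_kitSum_uniform
  refine ⟨C₁, C₂, hC₁, hC₂, fun R hR2 => ?_⟩
  obtain ⟨c₃, hc₃, U₀, hU₀, h'⟩ := h R hR2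
  refine ⟨c₃, hc₃, U₀, hU₀, ?_⟩
  intro P c hP hc hc6 hc₃' μ hμ U hU hU9 hU₀' β hβmin hβc K hK L M _ _ hL3 hM3 d k J' hd hk1 hkJ hJN t p h1 h3 Nb hN0 hN Ωe hlev
  have hβ : 0 < β := KLRegimeSplit.pos_of_klBetaMin_le hβmin
  have hu : 0 < klLevUnitF β M t p J' := klLevUnitF_pos hβ t p _
  set e : ℕ := p + (t : ℕ) - klLevGain t - 3 with he
  have hN' : ∀ Ωe' : Fin (2 * p - 1 + 1) → Option (SectorLeg (sectorCount (d - 1))), levelCount Ωe' = (t : ℕ) + 1 →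
      klLevNormOf L M β μ K (d - 1) (2 * p - 1 + 1) (klTowerInput L M β U μ K d 1) Ωe' ≤ Nb := by
    rw [show 2 * p - 1 + 1 = 2 * p by omega]; exact hN
  have hrow₀ := h' (2 * p - 1) P c hP hc hc6 hc₃' μ hμ U hU hU9 hU₀' β hβmin hβc K hK L M hL3 hM3 d k J' hd hk1 hkJ hJN ((t : ℕ) + 1) Nb hN0 hN'
  rw [show 2 * p - 1 + 1 = 2 * p by omega] at hrow₀
  have hrow := hrow₀ Ωe hlev
  -- the base summand in floor units at `J′`
  have hdJ : d - 1 ≤ J' := by have := Nat.le_mul_of_pos_right d hk1; omega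
  have hbs : C₁ * C₂ ^ (2 * p - 1) * ((2 : ℝ) ^ (J' - (d - 1))) ^ (2 * p - 1 - ((t : ℕ) + 1)) * Nb / klLevUnitF β M t p J' =
      C₁ * C₂ ^ (2 * p - 1) * ((((2 : ℝ) ^ e)⁻¹) ^ (J' - (d - 1)) * (Nb / klLevUnitF β M t p (d - 1))) := by
    obtain ⟨Δ, hΔ⟩ : ∃ Δ, J' = (d - 1) + Δ := ⟨J' - (d - 1), by omega⟩
    have hΔ' : J' - (d - 1) = Δ := by omega
    rw [hΔ', mul_assoc (C₁ * C₂ ^ (2 * p - 1)), mul_div_assoc, hΔ, jumpPow_mul_div_klLevUnitF_add (M := M) hβ t h1 h3 (d - 1) Δ Nb]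
  -- the born summands in floor units at `J′`
  have hborn : ∀ k' ∈ Ico 1 k, C₁ * C₂ ^ (2 * p - 1) * ((2 : ℝ) ^ (J' - d * k')) ^ (2 * p - 1 - ((t : ℕ) + 1)) *
      klTowerBornLev L M β U μ K d k' (2 * p) ((t : ℕ) + 1) / klLevUnitF β M t p J' =
      C₁ * C₂ ^ (2 * p - 1) * ((((2 : ℝ) ^ e)⁻¹) ^ (J' - d * k') * klTowerBLevF L M β U μ K d t (k' + 1) p) := by
    intro k' hk'
    have hk'k : k' < k := (mem_Ico.1 hk').2
    have hle : d * k' ≤ J' := by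
      have : d * k' + d ≤ d * k := by rw [← Nat.mul_succ]; exact Nat.mul_le_mul_left d hk'k
      omega
    obtain ⟨Δ, hΔ⟩ : ∃ Δ, J' = d * k' + Δ := ⟨J' - d * k', by omega⟩
    have hΔ' : J' - d * k' = Δ := by omega
    rw [hΔ', mul_assoc (C₁ * C₂ ^ (2 * p - 1)), mul_div_assoc, hΔ, jumpPow_mul_div_klLevUnitF_add (M := M) hβ t h1 h3 (d * k') Δ,
      ← klTowerBLevF_succ]
  -- divide the absolute row by the unit at `J′`
  have hdiv : klLevNormOf L M β μ K J' (2 * p) (klTowerInput L M β U μ K d k) Ωe / klLevUnitF β M t p J' ≤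
      C₁ * C₂ ^ (2 * p - 1) * ((((2 : ℝ) ^ e)⁻¹) ^ (J' - (d - 1)) * (Nb / klLevUnitF β M t p (d - 1))) +
        ∑ k' ∈ Ico 1 k, C₁ * C₂ ^ (2 * p - 1) * ((((2 : ℝ) ^ e)⁻¹) ^ (J' - d * k') * klTowerBLevF L M β U μ K d t (k' + 1) p) := by
    have h2 := div_le_div_of_nonneg_right hrow hu.le
    rw [add_div, sum_div, hbs, sum_congr rfl hborn] at h2
    exact h2
  calc (27 : ℝ) ^ ((t : ℕ) + 1) * klLevNormOf L M β μ K J' (2 * p) (klTowerInput L M β U μ K d k) Ωe / klLevUnitF β M t p J'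
      = (27 : ℝ) ^ ((t : ℕ) + 1) * (klLevNormOf L M β μ K J' (2 * p) (klTowerInput L M β U μ K d k) Ωe / klLevUnitF β M t p J') := by
        ring
    _ ≤ (27 : ℝ) ^ ((t : ℕ) + 1) * (C₁ * C₂ ^ (2 * p - 1) * ((((2 : ℝ) ^ e)⁻¹) ^ (J' - (d - 1)) * (Nb / klLevUnitF β M t p (d - 1))) +
          ∑ k' ∈ Ico 1 k, C₁ * C₂ ^ (2 * p - 1) * ((((2 : ℝ) ^ e)⁻¹) ^ (J' - d * k') * klTowerBLevF L M β U μ K d t (k' + 1) p)) :=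
        mul_le_mul_of_nonneg_left hdiv (by positivity)
    _ = (27 : ℝ) ^ ((t : ℕ) + 1) * (C₁ * C₂ ^ (2 * p - 1)) *
          ((((2 : ℝ) ^ e)⁻¹) ^ (J' - (d - 1)) * (Nb / klLevUnitF β M t p (d - 1)) +
            ∑ k' ∈ Ico 1 k, (((2 : ℝ) ^ e)⁻¹) ^ (J' - d * k') * klTowerBLevF L M β U μ K d t (k' + 1) p) := by
        rw [← mul_sum]; ring

/-! ## §5 The read-out profile: the law's input profile verbatim -/

omit [NeZero L] [NeZero M] in
/-- **THE READ-OUT PROFILE FROM THE LAW, per track, RATE KEPT — the SAME constants as `klTowerMuLevAtF_le_profileR_base`.**  Under the binders of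
`readoutLevF_le_kitSum`, for `d ≥ 2`, `k ≥ 1`, `dk ≤ J′`, `2d − 2 ≤ J′`, `J′ ≤ nScales β + 1`, a degree cap `D`, nonnegative `A, λ, Q, A_b, Q_b`, base bounds
`N_b t p` with the base unit law `N_b t p / klLevUnitF … t p (d−1) ≤ A_b λ^{p−1} Q_b^p` (`3 ≤ p`) and the law `klTowerBLevF … d t k′ p ≤ A λ^{p−1} Q^p` on the
blocks `2 ≤ k′ ≤ k`: for every track `t`, `3 ≤ p ≤ D` with `2p + t ≥ 7` and every prescription `Ωe` of level `t + 1` at the read-out family `F_{J′}`,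
`27^{t+1}·klLevNormOf … J′ (2p) 𝒱_{dk} Ωe / klLevUnitF … t p J′ ≤ 27⁵(C₁/C₂)·8^{d−1}·(A_b + A/(1 − (2^d)⁻¹))·λ^{p−1}·(C₂²(2^{d−1})⁻¹·max Q Q_b)^p`.
[cite: BenfattoGiulianiMastropietro2006, §2.8 (2.83), (2.93)-(2.98)] -/
theorem readoutLevF_le_profileR :
    ∃ C₁ C₂ : ℝ, 0 < C₁ ∧ 0 < C₂ ∧ ∀ R : RenConsts, R.WF2 → ∃ c₃' : ℝ, 0 < c₃' ∧ ∃ U₀' : ℝ, 0 < U₀' ∧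
      ∀ (P : SplitConsts) (c : ℝ), P.WF → 0 < c → c ≤ klEngC₃6 P R → c ≤ c₃' →
      ∀ μ ∈ klWindowC, ∀ U : ℝ, 0 < U → U ≤ klEngU₀9 P R c → U ≤ U₀' → ∀ β : ℝ, klBetaMin ≤ β → β ≤ Real.exp (c / U ^ 2) →
      ∀ K : TrigPolyC4v, FrameOK R U (nScales β) μ K → ∀ (L M : ℕ) [NeZero L] [NeZero M],
      klEngL₃ β U ≤ L → klEngM₃ β U L ≤ M → ∀ d k J' : ℕ, 2 ≤ d → 1 ≤ k → d * k ≤ J' → 2 * d - 2 ≤ J' → J' ≤ nScales β + 1 → ∀ D : ℕ,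
      ∀ (A lam Q Ab Qb : ℝ), 0 ≤ A → 0 ≤ lam → 0 ≤ Q → 0 ≤ Ab → 0 ≤ Qb →
      ∀ Nb : Fin 5 → ℕ → ℝ, (∀ t p, 0 ≤ Nb t p) →
        (∀ (t : Fin 5) (p : ℕ) (Ωe' : Fin (2 * p) → Option (SectorLeg (sectorCount (d - 1)))), levelCount Ωe' = (t : ℕ) + 1 →
          klLevNormOf L M β μ K (d - 1) (2 * p) (klTowerInput L M β U μ K d 1) Ωe' ≤ Nb t p) →
        (∀ (t : Fin 5) (p : ℕ), 3 ≤ p → Nb t p / klLevUnitF β M t p (d - 1) ≤ Ab * lam ^ (p - 1) * Qb ^ p) →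
        (∀ k' : ℕ, 2 ≤ k' → k' ≤ k → ∀ (t : Fin 5) (p : ℕ), 3 ≤ p → p ≤ D → klTowerBLevF L M β U μ K d t k' p ≤ A * lam ^ (p - 1) * Q ^ p) →
      ∀ (t : Fin 5) (p : ℕ), 3 ≤ p → p ≤ D → 7 ≤ 2 * p + (t : ℕ) →
      ∀ Ωe : Fin (2 * p) → Option (SectorLeg (sectorCount J')), levelCount Ωe = (t : ℕ) + 1 →
        (27 : ℝ) ^ ((t : ℕ) + 1) * klLevNormOf L M β μ K J' (2 * p) (klTowerInput L M β U μ K d k) Ωe / klLevUnitF β M t p J' ≤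
          (27 : ℝ) ^ 5 * (C₁ / C₂) * (8 : ℝ) ^ (d - 1) * (Ab + A / (1 - ((2 : ℝ) ^ d)⁻¹)) * lam ^ (p - 1) *
            (C₂ ^ 2 * ((2 : ℝ) ^ (d - 1))⁻¹ * max Q Qb) ^ p := by
  obtain ⟨C₁, C₂, hC₁, hC₂, h⟩ := readoutLevF_le_kitSum
  refine ⟨C₁, C₂, hC₁, hC₂, fun R hR2 => ?_⟩
  obtain ⟨c₃, hc₃, U₀, hU₀, h'⟩ := h R hR2
  refine ⟨c₃, hc₃, U₀, hU₀, ?_⟩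
  intro P c hP hc hc6 hc₃' μ hμ U hU hU9 hU₀' β hβmin hβc K hK L M _ _ hL3 hM3 d k J' hd hk1 hkJ h2d hJN D A lam Q Ab Qb hA hlam hQ hAb hQb Nb hNb0 hcar
    hlawb hIH t p hp hpD hpt Ωe hlev
  have hβ : 0 < β := KLRegimeSplit.pos_of_klBetaMin_le hβmin
  have ht4 : (t : ℕ) ≤ 4 := by have := t.isLt; omega
  have hg := klLevGain_le t
  have hg2 : 2 * klLevGain t ≤ (t : ℕ) := by
    unfold klLevGain levelGainExp
    have := t.isLt
    omega
  -- the rate `ρ = (2^d)⁻¹ ∈ (0, 1)` and the block gain `γ = (2^{d−1})⁻¹ ≤ 1`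
  set ρ : ℝ := ((2 : ℝ) ^ d)⁻¹ with hρ
  have hsd1 : (1 : ℝ) < (2 : ℝ) ^ d := one_lt_pow₀ (by norm_num) (by omega)
  have hρ0 : 0 < ρ := by positivity
  have hρ1 : ρ < 1 := inv_lt_one_of_one_lt₀ hsd1
  have hρle : ρ ≤ 1 := hρ1.le
  have h1ρ : 0 < 1 - ρ := sub_pos.2 hρ1
  set γ : ℝ := ((2 : ℝ) ^ (d - 1))⁻¹ with hγ
  have hγ0 : 0 ≤ γ := by positivity
  have hγ1 : γ ≤ 1 := inv_le_one_of_one_le₀ (one_le_pow₀ (by norm_num))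
  -- the exponent `e = p + t − klLevGain t − 3 ≥ 1` and the gain `G = γ^e`
  set e : ℕ := p + (t : ℕ) - klLevGain t - 3 with he
  have he1 : 1 ≤ e := by omega
  set G : ℝ := γ ^ e with hG
  have hG0 : 0 ≤ G := by positivity
  have hGle : G ≤ (8 : ℝ) ^ (d - 1) * (((2 : ℝ) ^ (d - 1))⁻¹) ^ p := by
    rw [hG]
    have h1 : γ ^ e ≤ γ ^ (p - 3) := pow_le_pow_of_le_one hγ0 hγ1 (by omega)
    refine h1.trans (le_of_eq ?_)
    have h2 : (0 : ℝ) < (2 : ℝ) ^ (d - 1) := by positivity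
    obtain ⟨q, rfl⟩ : ∃ q, p = q + 3 := ⟨p - 3, by omega⟩
    rw [Nat.add_sub_cancel, hγ, pow_add, inv_pow, inv_pow]
    have h8 : (8 : ℝ) ^ (d - 1) = ((2 : ℝ) ^ (d - 1)) ^ 3 := by
      rw [← pow_mul, mul_comm, pow_mul]; norm_num
    rw [h8]
    field_simp
  -- the base inverse `b⁻¹ = (2^e)⁻¹ ≤ 1`, and `(b⁻¹)^{d−1} = G`, `(b⁻¹)^d = ρ^e ≤ ρ`
  have hb : ((2 : ℝ) ^ e)⁻¹ ≤ 1 := inv_le_one_of_one_le₀ (one_le_pow₀ (by norm_num))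
  have hb0 : 0 ≤ ((2 : ℝ) ^ e)⁻¹ := by positivity
  have hGeq : ((2 : ℝ) ^ e)⁻¹ ^ (d - 1) = G := by
    rw [hG, hγ, inv_pow, inv_pow, ← pow_mul, ← pow_mul, mul_comm]
  have hρe : ((2 : ℝ) ^ e)⁻¹ ^ d = ρ ^ e := by
    rw [hρ, inv_pow, inv_pow, ← pow_mul, ← pow_mul, mul_comm]
  have hρe1 : ρ ^ e ≤ ρ := by
    calc ρ ^ e ≤ ρ ^ 1 := pow_le_pow_of_le_one hρ0.le hρle he1
      _ = ρ := pow_one ρ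
  have hmain := h' P c hP hc hc6 hc₃' μ hμ U hU hU9 hU₀' β hβmin hβc K hK L M hL3 hM3 d k J' hd hk1 hkJ hJN t p (by omega) (by omega) (Nb t p)
    (hNb0 t p) (hcar t p) Ωe hlev
  -- laws
  set law : ℕ → ℝ := fun p => A * lam ^ (p - 1) * Q ^ p with hlaw
  have hlaw0 : 0 ≤ law p := by positivity
  have hu0 : 0 < klLevUnitF β M t p (d - 1) := klLevUnitF_pos hβ t p (d - 1)
  -- (i) the base term carries `G` (since `J′ − (d−1) ≥ d − 1`)
  have hUVt : ((2 : ℝ) ^ e)⁻¹ ^ (J' - (d - 1)) * (Nb t p / klLevUnitF β M t p (d - 1)) ≤ G * (Ab * lam ^ (p - 1) * Qb ^ p) := by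
    have hdk : d - 1 ≤ J' - (d - 1) := by omega
    have hpow : ((2 : ℝ) ^ e)⁻¹ ^ (J' - (d - 1)) ≤ ((2 : ℝ) ^ e)⁻¹ ^ (d - 1) := pow_le_pow_of_le_one hb0 hb hdk
    have hq0 : 0 ≤ Nb t p / klLevUnitF β M t p (d - 1) := div_nonneg (hNb0 t p) hu0.le
    calc ((2 : ℝ) ^ e)⁻¹ ^ (J' - (d - 1)) * (Nb t p / klLevUnitF β M t p (d - 1)) ≤ G * (Nb t p / klLevUnitF β M t p (d - 1)) := by
          rw [← hGeq]; exact mul_le_mul_of_nonneg_right hpow hq0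
      _ ≤ G * (Ab * lam ^ (p - 1) * Qb ^ p) := mul_le_mul_of_nonneg_left (hlawb t p hp) hG0
  -- (ii) the born sum: each term `≤ G·ρ^{k−1−k′}·law`, the sum `≤ G·law/(1−ρ)`
  have hterm : ∀ k' ∈ Ico 1 k, ((2 : ℝ) ^ e)⁻¹ ^ (J' - d * k') * klTowerBLevF L M β U μ K d t (k' + 1) p ≤ G * ρ ^ (k - 1 - k') * law p := by
    intro k' hk'
    obtain ⟨hk'1, hk'⟩ := mem_Ico.1 hk'
    set n : ℕ := k - 1 - k' with hn
    have hJk : (d - 1) + d * n ≤ J' - d * k' := by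
      have h1 : d * k' + d * n + d = d * k := by
        rw [hn, ← Nat.mul_add, ← Nat.mul_succ]; congr 1; omega
      omega
    have hb' : klTowerBLevF L M β U μ K d t (k' + 1) p ≤ law p := hIH (k' + 1) (by omega) (by omega) t p hp hpD
    have hb0' : 0 ≤ klTowerBLevF L M β U μ K d t (k' + 1) p := klTowerBLevF_nonneg hβ U μ K d t (k' + 1) p
    have hrate : ((2 : ℝ) ^ e)⁻¹ ^ (J' - d * k') ≤ G * ρ ^ n := by
      calc ((2 : ℝ) ^ e)⁻¹ ^ (J' - d * k') ≤ ((2 : ℝ) ^ e)⁻¹ ^ ((d - 1) + d * n) := pow_le_pow_of_le_one hb0 hb hJk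
        _ = G * (ρ ^ e) ^ n := by rw [pow_add, hGeq, pow_mul, hρe]
        _ ≤ G * ρ ^ n := mul_le_mul_of_nonneg_left (pow_le_pow_left₀ (by positivity) hρe1 n) hG0
    calc ((2 : ℝ) ^ e)⁻¹ ^ (J' - d * k') * klTowerBLevF L M β U μ K d t (k' + 1) p
        ≤ G * ρ ^ n * klTowerBLevF L M β U μ K d t (k' + 1) p := mul_le_mul_of_nonneg_right hrate hb0'
      _ ≤ G * ρ ^ n * law p := mul_le_mul_of_nonneg_left hb' (by positivity)
  have hsum : ∑ k' ∈ Ico 1 k, ((2 : ℝ) ^ e)⁻¹ ^ (J' - d * k') * klTowerBLevF L M β U μ K d t (k' + 1) p ≤ G * (law p / (1 - ρ)) := by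
    refine (sum_le_sum hterm).trans ?_
    have hsub : Ico 1 k ⊆ range k := fun k' hk' => mem_range.2 (mem_Ico.1 hk').2
    refine (sum_le_sum_of_subset_of_nonneg hsub (fun k' _ _ => by positivity)).trans ?_
    have hre : ∑ k' ∈ range k, G * ρ ^ (k - 1 - k') * law p = G * ((∑ j ∈ range k, ρ ^ j) * law p) := by
      rw [← sum_range_reflect (fun j => ρ ^ j) k, sum_mul, mul_sum]
      refine sum_congr rfl fun k' _ => ?_
      ring
    rw [hre]
    refine mul_le_mul_of_nonneg_left ?_ hG0
    calc (∑ j ∈ range k, ρ ^ j) * law p ≤ 1 / (1 - ρ) * law p :=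
          mul_le_mul_of_nonneg_right (geom_sum_range_le_inv_one_sub hρ0.le hρ1 k) hlaw0
      _ = law p / (1 - ρ) := by rw [one_div, inv_mul_eq_div]
  -- (iii) assemble
  have hpre0 : 0 ≤ (27 : ℝ) ^ ((t : ℕ) + 1) * (C₁ * C₂ ^ (2 * p - 1)) := by positivity
  have h27 : (27 : ℝ) ^ ((t : ℕ) + 1) ≤ 27 ^ 5 := pow_le_pow_right₀ (by norm_num) (by omega)
  set Mq := max Q Qb with hMq
  have hQM : Q ≤ Mq := le_max_left _ _
  have hQbM : Qb ≤ Mq := le_max_right _ _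
  have hMq0 : 0 ≤ Mq := hQ.trans hQM
  set δ : ℝ := ((2 : ℝ) ^ (d - 1))⁻¹ with hδ
  have hδ0 : 0 ≤ δ := by positivity
  have hin : Ab * lam ^ (p - 1) * Qb ^ p + law p / (1 - ρ) ≤ (Ab + A / (1 - ρ)) * lam ^ (p - 1) * Mq ^ p := by
    have h1 : Ab * lam ^ (p - 1) * Qb ^ p ≤ Ab * lam ^ (p - 1) * Mq ^ p :=
      mul_le_mul_of_nonneg_left (pow_le_pow_left₀ hQb hQbM p) (by positivity)
    have h2 : law p / (1 - ρ) ≤ A / (1 - ρ) * lam ^ (p - 1) * Mq ^ p := by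
      rw [hlaw]; dsimp only
      rw [div_eq_mul_inv, show A / (1 - ρ) * lam ^ (p - 1) * Mq ^ p = A * lam ^ (p - 1) * Mq ^ p * (1 - ρ)⁻¹ by ring]
      exact mul_le_mul_of_nonneg_right (mul_le_mul_of_nonneg_left (pow_le_pow_left₀ hQ hQM p) (by positivity))
        (inv_nonneg.2 h1ρ.le)
    calc Ab * lam ^ (p - 1) * Qb ^ p + law p / (1 - ρ) ≤ Ab * lam ^ (p - 1) * Mq ^ p + A / (1 - ρ) * lam ^ (p - 1) * Mq ^ p :=
          add_le_add h1 h2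
      _ = (Ab + A / (1 - ρ)) * lam ^ (p - 1) * Mq ^ p := by ring
  have hA0 : 0 ≤ Ab + A / (1 - ρ) := by have : 0 ≤ A / (1 - ρ) := div_nonneg hA h1ρ.le; positivity
  have hin0 : 0 ≤ (Ab + A / (1 - ρ)) * lam ^ (p - 1) * Mq ^ p := by positivity
  have hC : C₁ * C₂ ^ (2 * p - 1) = C₁ / C₂ * (C₂ ^ 2) ^ p := by
    have hpw : (C₂ ^ 2) ^ p = C₂ ^ (2 * p - 1) * C₂ := by
      rw [← pow_mul, ← pow_succ]; congr 1; omega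
    rw [hpw]
    field_simp
  calc (27 : ℝ) ^ ((t : ℕ) + 1) * klLevNormOf L M β μ K J' (2 * p) (klTowerInput L M β U μ K d k) Ωe / klLevUnitF β M t p J'
      ≤ (27 : ℝ) ^ ((t : ℕ) + 1) * (C₁ * C₂ ^ (2 * p - 1)) *
          (((2 : ℝ) ^ e)⁻¹ ^ (J' - (d - 1)) * (Nb t p / klLevUnitF β M t p (d - 1)) +
            ∑ k' ∈ Ico 1 k, ((2 : ℝ) ^ e)⁻¹ ^ (J' - d * k') * klTowerBLevF L M β U μ K d t (k' + 1) p) := hmain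
    _ ≤ (27 : ℝ) ^ ((t : ℕ) + 1) * (C₁ * C₂ ^ (2 * p - 1)) * (G * (Ab * lam ^ (p - 1) * Qb ^ p) + G * (law p / (1 - ρ))) :=
        mul_le_mul_of_nonneg_left (add_le_add hUVt hsum) hpre0
    _ = (27 : ℝ) ^ ((t : ℕ) + 1) * (C₁ * C₂ ^ (2 * p - 1)) * G * (Ab * lam ^ (p - 1) * Qb ^ p + law p / (1 - ρ)) := by ring
    _ ≤ (27 : ℝ) ^ 5 * (C₁ * C₂ ^ (2 * p - 1)) * ((8 : ℝ) ^ (d - 1) * δ ^ p) * ((Ab + A / (1 - ρ)) * lam ^ (p - 1) * Mq ^ p) := by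
        have hsum0 : 0 ≤ Ab * lam ^ (p - 1) * Qb ^ p + law p / (1 - ρ) := add_nonneg (by positivity) (div_nonneg hlaw0 h1ρ.le)
        have h1 : (27 : ℝ) ^ ((t : ℕ) + 1) * (C₁ * C₂ ^ (2 * p - 1)) * G ≤ 27 ^ 5 * (C₁ * C₂ ^ (2 * p - 1)) * ((8 : ℝ) ^ (d - 1) * δ ^ p) :=
          mul_le_mul (mul_le_mul_of_nonneg_right h27 (by positivity)) hGle hG0 (by positivity)
        exact mul_le_mul h1 hin hsum0 (by positivity)
    _ = (27 : ℝ) ^ 5 * (C₁ / C₂) * (8 : ℝ) ^ (d - 1) * (Ab + A / (1 - ρ)) * lam ^ (p - 1) * (C₂ ^ 2 * δ * Mq) ^ p := by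
        rw [hC, mul_pow, mul_pow]; ring

end Summit.HubbardSuperconductivity.HubbardSuperconductivity.Theorems.EngineV8

end
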